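import Literature.NumberTheory.GaloisRepresentations.ValuationPadicDiscreteness
import Mathlib.RingTheory.LocalRing.ResidueField.Basic
import Mathlib.RingTheory.Polynomial.Content
import Mathlib.RingTheory.Polynomial.Tower
import Mathlib.Algebra.GCDMonoid.Nat
import Mathlib.Algebra.Algebra.ZMod
import Mathlib.Algebra.Field.ZMod
import Mathlib.Algebra.CharP.Lemmas
import Mathlib.Algebra.Ring.GeomSum
import Mathlib.GroupTheory.Torsion
import Mathlib.Tactic.LinearCombination
import HarnessLib

/-!
# Infinitely divisible units in discretely valued fields algebraic over `ℚ`

Second half of the generic valuation-theoretic engine behind [AbsTopIII] Remark 1.5.3 (i)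
(S. Mochizuki, *Topics in Absolute Anabelian Geometry III*, kurims manuscript p. 33, lit key
`paper:url-5493eb38cbb7`) [cite: MochizukiAbsTopIII2015, Rmk 1.5.3 (i) p.33]: for an algebraic
extension `k` of a number field carrying a nonarchimedean prime UNRAMIFIED over a number field
inside `k`, and with `μ(k†)` finite for every finite extension `k†/k`, "`⋂_N (k^×)^N = {1}`" — in
print: an `f ∉ μ(k)` with arbitrary `p`-power roots in the completion `k_𝔭` (a subfield of a
finite extension of `Frac W(𝔽̄_p)`) "yields a contradiction".  This file supplies that
contradiction for an ABSTRACT valued field `(K, v : Valuation K Γ₀)`, in elementary form (no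
completion, no Witt vectors): weak discreteness (`ValuationPadicDiscreteness.lean`) + residue
field algebraic over `𝔽_p` + contraction of principal units under `u ↦ u^p`.  The number-field
assembly is
`Literature/AnabelianGeometry/AbsoluteAnabelian/AbsTopIII/KummerFaithfulRmk153iGeneralProofs.lean`.

## Contents (Mathlib-only; no definitions, no named facts)

* `valuation_sub_one_lt_one_of_pow_prime_pow` (injectivity of the residue Frobenius, valuation
  form), `valuation_pow_sub_one_le`, `valuation_pow_sub_one_le_mul_max` (principal units CONTRACT
  under `u ↦ u^p`: `v(u^p - 1) ≤ v(u - 1) · max(v(p), v(u - 1))`), and the iterated form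
  `valuation_pow_pow_sub_one_pow_le` under weak discreteness.
* `exists_pos_valuation_pow_sub_one_lt_one`: the residue class of a unit algebraic over `ℤ` has
  finite multiplicative order (the residue field is algebraic over `𝔽_p`).
* `units_eq_one_of_forall_exists_pow_eq_of_valuation`: THE ENGINE — if `v(p) < 1`, `v` is weakly
  discrete, unit residues have finite order and `μ(K)` is finite, then an element of `K^×` with
  `N`-th roots for all `N ≥ 1` equals `1`.
-/

noncomputable section

open scoped Classical
open Polynomial

namespace Literature.NumberTheory.GaloisRepresentations

variable {K : Type*} [Field K] {Γ₀ : Type*} [LinearOrderedCommGroupWithZero Γ₀]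
  (v : Valuation K Γ₀)

/-! ### Principal units: Frobenius injectivity and contraction -/

/-- A principal unit (`v(u - 1) < 1`) is a unit (`v(u) ≤ 1`).
[cite: MochizukiAbsTopIII2015, Rmk 1.5.3 (i) p.33] -/
theorem valuation_le_one_of_valuation_sub_one_lt_one {u : K} (hu : v (u - 1) < 1) : v u ≤ 1 := by
  have : u = (u - 1) + 1 := (sub_add_cancel u 1).symm
  rw [this]
  exact (v.map_add _ _).trans (max_le hu.le (le_of_eq v.map_one))

/-- `v(u^m − 1) ≤ v(u − 1)` for `v(u) ≤ 1` (`u^m − 1 = (u − 1)·Σ_{i<m} uⁱ`).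
[cite: MochizukiAbsTopIII2015, Rmk 1.5.3 (i) p.33] -/
theorem valuation_pow_sub_one_le {u : K} (hu : v u ≤ 1) (m : ℕ) : v (u ^ m - 1) ≤ v (u - 1) := by
  rw [← geom_sum_mul u m, map_mul]
  calc v (∑ i ∈ Finset.range m, u ^ i) * v (u - 1) ≤ 1 * v (u - 1) := by
        refine mul_le_mul_left (v.map_sum_le fun i _ => ?_) _
        rw [map_pow]
        exact valueGroup_pow_le_one hu i
    _ = v (u - 1) := one_mul _

/-- CONTRACTION of principal units under `u ↦ u^m`:
`v(u^m − 1) ≤ v(u − 1) · max(v(m), v(u − 1))`, since `u^m − 1 = (u − 1)·Σ_{i<m} uⁱ` and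
`Σ_{i<m} uⁱ ≡ m` modulo `u − 1`.  With `m = p` and `v(p) < 1` this is the mechanism by which
"arbitrary `p`-power roots" yield the contradiction in [AbsTopIII] Rmk. 1.5.3 (i).
[cite: MochizukiAbsTopIII2015, Rmk 1.5.3 (i) p.33] -/
theorem valuation_pow_sub_one_le_mul_max {u : K} (hu : v (u - 1) < 1) (m : ℕ) :
    v (u ^ m - 1) ≤ v (u - 1) * max (v (m : K)) (v (u - 1)) := by
  have hu' := valuation_le_one_of_valuation_sub_one_lt_one v hu
  have hgeom : u ^ m - 1 = (u - 1) * ∑ i ∈ Finset.range m, u ^ i := by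
    rw [mul_comm, geom_sum_mul]
  have hS : ∑ i ∈ Finset.range m, u ^ i = (m : K) + ∑ i ∈ Finset.range m, (u ^ i - 1) := by
    rw [Finset.sum_sub_distrib, Finset.sum_const, Finset.card_range, nsmul_eq_mul, mul_one]
    ring
  rw [hgeom, map_mul]
  refine mul_le_mul_right ?_ _
  rw [hS]
  exact (v.map_add _ _).trans
    (max_le_max le_rfl (v.map_sum_le fun i _ => valuation_pow_sub_one_le v hu' i))

/-- Injectivity of Frobenius on the residue field, valuation form: if `v(p) < 1`, `v(u) ≤ 1` and
`u^{pⁿ} ≡ 1`, then `u ≡ 1` modulo the maximal ideal (`(u − 1)^{pⁿ} = (u^{pⁿ} − 1) − p·r` with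
`r` in the valuation ring).  Hence `p`-power roots of principal units are principal units.
[cite: MochizukiAbsTopIII2015, Rmk 1.5.3 (i) p.33] -/
theorem valuation_sub_one_lt_one_of_pow_prime_pow {p : ℕ} [hp : Fact p.Prime]
    (hvp : v (p : K) < 1) {u : K} (hu : v u ≤ 1) (n : ℕ) (h : v (u ^ p ^ n - 1) < 1) :
    v (u - 1) < 1 := by
  have hu1 : u - 1 ∈ v.integer :=
    (v.mem_integer_iff _).mpr ((v.map_sub u 1).trans (max_le hu (le_of_eq v.map_one)))
  obtain ⟨r, hr⟩ := exists_add_pow_prime_pow_eq hp.out (⟨u - 1, hu1⟩ : v.integer) 1 n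
  have hr' : (u - 1) ^ p ^ n = (u ^ p ^ n - 1) - (p : K) * ((u - 1) * (r : K)) := by
    have h1 := congrArg (Subtype.val : v.integer → K) hr
    push_cast at h1
    linear_combination -h1
  by_contra hge
  push Not at hge
  have h1 : (1 : Γ₀) ≤ v ((u - 1) ^ p ^ n) := by
    rw [map_pow]
    obtain ⟨k, hk⟩ : ∃ k, p ^ n = k + 1 := ⟨p ^ n - 1, by have := pow_pos hp.out.pos n; omega⟩
    rw [hk]
    rcases eq_or_lt_of_le hge with h0 | h0
    · rw [← h0, one_pow]
    · exact (valueGroup_one_lt_pow_succ h0 k).le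
  have h2 : v ((u ^ p ^ n - 1) - (p : K) * ((u - 1) * (r : K))) < 1 := by
    refine lt_of_le_of_lt (v.map_sub _ _) (max_lt h ?_)
    rw [map_mul, map_mul]
    calc v (p : K) * (v (u - 1) * v (r : K)) ≤ v (p : K) * 1 :=
          mul_le_mul_right (mul_le_one' ((v.mem_integer_iff _).mp hu1)
            ((v.mem_integer_iff _).mp r.2)) _
      _ < 1 := by rw [mul_one]; exact hvp
  rw [hr'] at h1
  exact lt_irrefl _ (lt_of_le_of_lt h1 h2)

/-- Iterated contraction under WEAK DISCRETENESS (`v(x)^D ∈ v(p)^ℤ` on `K^×`, so the `D`-th power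
of every value `< 1` is `≤ v(p)`): for a principal unit `u`,
`v(u^{pⁿ} − 1)^D ≤ v(u − 1)^D · v(p)ⁿ`.  (`p` is any natural number with `0 ≠ p`, `v(p) < 1`.)
[cite: MochizukiAbsTopIII2015, Rmk 1.5.3 (i) p.33] -/
theorem valuation_pow_pow_sub_one_pow_le {p : ℕ} (hvp : v (p : K) < 1) (hp0 : (p : K) ≠ 0)
    {D : ℕ} (hD : 0 < D) (hdisc : ∀ x : K, x ≠ 0 → ∃ n : ℤ, v x ^ D = v (p : K) ^ n)
    {u : K} (hu : v (u - 1) < 1) (n : ℕ) :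
    v (u ^ p ^ n - 1) ^ D ≤ v (u - 1) ^ D * v (p : K) ^ n := by
  have ha0 : v (p : K) ≠ 0 := (Valuation.ne_zero_iff v).mpr hp0
  have hsmall : ∀ z : K, z ≠ 0 → v z < 1 → v z ^ D ≤ v (p : K) := by
    intro z hz hz1
    obtain ⟨k, hk⟩ := hdisc z hz
    rw [hk]
    exact valueGroup_zpow_le_self_of_zpow_lt_one ha0 hvp (by rw [← hk]; exact valueGroup_pow_lt_one hz1 hD)
  have step : ∀ w : K, v (w - 1) < 1 → v (w ^ p - 1) ^ D ≤ v (w - 1) ^ D * v (p : K) := by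
    intro w hw
    have h1 := valuation_pow_sub_one_le_mul_max v hw p
    have hρ : (max (v (p : K)) (v (w - 1))) ^ D ≤ v (p : K) := by
      rcases le_total (v (w - 1)) (v (p : K)) with hle | hle
      · rw [max_eq_left hle]
        exact hsmall _ hp0 hvp
      · rw [max_eq_right hle]
        by_cases hw0 : w - 1 = 0
        · rw [hw0, map_zero, zero_pow hD.ne']
          exact zero_le
        · exact hsmall _ hw0 hw
    calc v (w ^ p - 1) ^ D ≤ (v (w - 1) * max (v (p : K)) (v (w - 1))) ^ D :=
          valueGroup_pow_le_pow_left h1 D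
      _ = v (w - 1) ^ D * (max (v (p : K)) (v (w - 1))) ^ D := mul_pow _ _ _
      _ ≤ v (w - 1) ^ D * v (p : K) := mul_le_mul_right hρ _
  have hu' := valuation_le_one_of_valuation_sub_one_lt_one v hu
  induction n with
  | zero => simp
  | succ n ih =>
    have hn1 : v (u ^ p ^ n - 1) < 1 := lt_of_le_of_lt (valuation_pow_sub_one_le v hu' _) hu
    calc v (u ^ p ^ (n + 1) - 1) ^ D = v ((u ^ p ^ n) ^ p - 1) ^ D := by rw [pow_succ, pow_mul]
      _ ≤ v (u ^ p ^ n - 1) ^ D * v (p : K) := step _ hn1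
      _ ≤ (v (u - 1) ^ D * v (p : K) ^ n) * v (p : K) := mul_le_mul_left ih _
      _ = v (u - 1) ^ D * v (p : K) ^ (n + 1) := by rw [mul_assoc, pow_succ]

/-! ### Residue classes of algebraic units have finite order -/

/-- If `v(p) < 1` for a prime `p` and `u` is a `v`-unit algebraic over `ℤ`, then the residue class
of `u` has finite multiplicative order: `v(u^m − 1) < 1` for some `m ≥ 1`.  (The residue field has
characteristic `p`; a PRIMITIVE integer polynomial killing `u` stays nonzero mod `p`, so the
residue of `u` is algebraic over `𝔽_p` and generates a finite field.)  This is the use of "the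
residue field of `k_𝔭` is algebraic over `𝔽_p`" (`k_𝔭` inside a finite extension of
`Frac W(𝔽̄_p)`) in [AbsTopIII] Rmk. 1.5.3 (i). [cite: MochizukiAbsTopIII2015, Rmk 1.5.3 (i) p.33] -/
theorem exists_pos_valuation_pow_sub_one_lt_one [CharZero K] {p : ℕ} [hp : Fact p.Prime]
    (hvp : v (p : K) < 1) {u : K} (hu : v u = 1) (halg : IsAlgebraic ℤ u) :
    ∃ m : ℕ, 0 < m ∧ v (u ^ m - 1) < 1 := by
  haveI : NeZero p := ⟨hp.out.ne_zero⟩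
  -- the valuation ring `W`, a local ring, and its residue field
  set W := v.valuationSubring with hWdef
  have hvW : v.IsEquiv W.valuation := Valuation.isEquiv_valuation_valuationSubring v
  have hmax : ∀ x : W, x ∈ IsLocalRing.maximalIdeal W ↔ v (x : K) < 1 := fun x => by
    rw [ValuationSubring.valuation_lt_one_iff]
    exact hvW.lt_one_iff_lt_one.symm
  have huW : u ∈ W := (Valuation.mem_valuationSubring_iff v u).mpr hu.le
  let uW : W := ⟨u, huW⟩
  have huW' : (uW : K) = u := rfl
  -- the residue field has characteristic `p`
  have hpW : (p : W) ∈ IsLocalRing.maximalIdeal W := by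
    rw [hmax]
    have : ((p : W) : K) = p := map_natCast W.subtype p
    rw [this]
    exact hvp
  haveI : CharP (IsLocalRing.ResidueField W) p := by
    have h0 : (p : IsLocalRing.ResidueField W) = 0 := by
      rw [← map_natCast (IsLocalRing.residue W) p, IsLocalRing.residue_eq_zero_iff]
      exact hpW
    rcases (Nat.dvd_prime hp.out).mp ((ringChar.spec _ p).mp h0) with h1 | h1
    · exact absurd h1 CharP.ringChar_ne_one
    · exact ringChar.of_eq h1
  letI : Algebra (ZMod p) (IsLocalRing.ResidueField W) := ZMod.algebra _ p
  -- a primitive integer polynomial vanishing at `u`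
  obtain ⟨P, hP0, hPu⟩ := halg
  have hQu : aeval u P.primPart = 0 := by
    have hc : (P.content : K) ≠ 0 := by exact_mod_cast mt Polynomial.content_eq_zero_iff.mp hP0
    have h := hPu
    rw [P.eq_C_content_mul_primPart, map_mul, Polynomial.aeval_C, algebraMap_int_eq,
      eq_intCast] at h
    exact (mul_eq_zero.mp h).resolve_left hc
  have hQuW : aeval uW P.primPart = 0 := by
    apply Subtype.val_injective
    show ((aeval uW P.primPart : W) : K) = ((0 : W) : K)
    rw [ZeroMemClass.coe_zero,
      show ((aeval uW P.primPart : W) : K) = W.subtype.toIntAlgHom (aeval uW P.primPart) from rfl,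
      ← Polynomial.aeval_algHom_apply]
    exact hQu
  have hQres : aeval (IsLocalRing.residue W uW) P.primPart = 0 := by
    rw [show IsLocalRing.residue W uW = (IsLocalRing.residue W).toIntAlgHom uW from rfl,
      Polynomial.aeval_algHom_apply, hQuW, map_zero]
  -- its reduction mod `p` is nonzero
  have hQp0 : P.primPart.map (Int.castRingHom (ZMod p)) ≠ 0 := by
    intro h0
    have hdvd : C (p : ℤ) ∣ P.primPart := by
      rw [Polynomial.C_dvd_iff_dvd_coeff]
      intro i
      have hi : (Int.castRingHom (ZMod p)) (P.primPart.coeff i) = 0 := by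
        rw [← Polynomial.coeff_map, h0, Polynomial.coeff_zero]
      exact (ZMod.intCast_zmod_eq_zero_iff_dvd _ p).mp hi
    have hunit := P.isPrimitive_primPart (p : ℤ) hdvd
    rw [Int.isUnit_iff] at hunit
    have := hp.out.two_le
    omega
  -- the residue of `u` is algebraic over `𝔽_p`, hence generates a finite field
  have halgp : IsAlgebraic (ZMod p) (IsLocalRing.residue W uW) := by
    refine ⟨P.primPart.map (Int.castRingHom (ZMod p)), hQp0, ?_⟩
    rw [Polynomial.aeval_def, Polynomial.eval₂_map,
      RingHom.ext_int ((algebraMap (ZMod p) _).comp (Int.castRingHom (ZMod p))) (algebraMap ℤ _),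
      ← Polynomial.aeval_def, hQres]
  have hint : IsIntegral (ZMod p) (IsLocalRing.residue W uW) :=
    IsAlgebraic.isIntegral (K := ZMod p) halgp
  haveI := IntermediateField.adjoin.finiteDimensional
    (K := ZMod p) (L := IsLocalRing.ResidueField W) hint
  set E := IntermediateField.adjoin (ZMod p) {IsLocalRing.residue W uW} with hEdef
  haveI : Finite E := Module.finite_of_finite (ZMod p)
  -- and is nonzero, so it has finite order `m`
  have hres0 : IsLocalRing.residue W uW ≠ 0 := by
    rw [Ne, IsLocalRing.residue_eq_zero_iff, hmax, huW', hu]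
    exact lt_irrefl 1
  have hmemE : IsLocalRing.residue W uW ∈ E :=
    IntermediateField.mem_adjoin_simple_self (ZMod p) _
  have hE0 : (⟨IsLocalRing.residue W uW, hmemE⟩ : E) ≠ 0 :=
    fun h => hres0 (congrArg Subtype.val h)
  obtain ⟨m, hm, hUm⟩ :=
    isOfFinOrder_iff_pow_eq_one.mp (isOfFinOrder_of_finite (Units.mk0 _ hE0))
  refine ⟨m, hm, ?_⟩
  have hresm : IsLocalRing.residue W uW ^ m = 1 := by
    have h1 := congrArg (fun z : Eˣ => ((z : E) : IsLocalRing.ResidueField W)) hUm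
    simpa using h1
  have hmem : uW ^ m - 1 ∈ IsLocalRing.maximalIdeal W := by
    rw [← IsLocalRing.residue_eq_zero_iff, map_sub, map_pow, map_one, hresm, sub_self]
  have h := (hmax _).mp hmem
  push_cast at h
  rw [huW'] at h
  exact h

/-! ### The engine -/

/-- THE ENGINE of [AbsTopIII] Rmk. 1.5.3 (i) for an abstract valued field `(K, v)`: suppose
`v(p) < 1` for a prime `p` (nonzero in `K`), `v` is WEAKLY DISCRETE (`v(x)^D ∈ v(p)^ℤ` on `K^×`,
some `D ≥ 1`), residue classes of units have finite order, and `μ(K)` is finite.  Then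
`⋂_N (K^×)^N = {1}`: an `f ∈ K^×` admitting `N`-th roots for all `N ≥ 1` equals `1`.  Print: "If
`f ∈ μ(k)`, then the assumption concerning `μ(k)` implies immediately that `f = 1` [...] the fact
that `f` admits arbitrary `p`-power roots in `k_𝔭` yields a contradiction."  Here: `v(f) = 1` by
discreteness; some power `F = f^m ≡ 1`; the `pⁿ`-th roots of `F` are `≡ 1` (Frobenius injectivity),
so contraction gives `v(F − 1)^D ≤ v(p)ⁿ` for all `n`, i.e. `F = 1`; thus `f ∈ μ(K)`, and an
`#μ(K)`-th root of `f` is torsion as well, so `f = 1`.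
[cite: MochizukiAbsTopIII2015, Rmk 1.5.3 (i) p.33] -/
theorem units_eq_one_of_forall_exists_pow_eq_of_valuation {p : ℕ} [hp : Fact p.Prime]
    (hvp : v (p : K) < 1) (hp0 : (p : K) ≠ 0) {D : ℕ} (hD : 0 < D)
    (hdisc : ∀ x : K, x ≠ 0 → ∃ n : ℤ, v x ^ D = v (p : K) ^ n)
    (hres : ∀ u : K, v u = 1 → ∃ m : ℕ, 0 < m ∧ v (u ^ m - 1) < 1)
    [Finite (CommGroup.torsion Kˣ)] (f : Kˣ) (hf : ∀ N : ℕ, 0 < N → ∃ g : Kˣ, g ^ N = f) :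
    f = 1 := by
  have ha0 : v (p : K) ≠ 0 := (Valuation.ne_zero_iff v).mpr hp0
  -- (1) infinitely divisible elements (and their roots) are `v`-units
  have hunit : ∀ x : Kˣ, (∀ N : ℕ, 0 < N → ∃ g : Kˣ, g ^ N = x) → v (x : K) = 1 := by
    intro x hx
    obtain ⟨k, hk⟩ := hdisc x x.ne_zero
    obtain ⟨g, hg⟩ := hx (k.natAbs + 1) (Nat.succ_pos _)
    obtain ⟨j, hj⟩ := hdisc g g.ne_zero
    have hkj : k = j * ((k.natAbs + 1 : ℕ) : ℤ) := by
      refine valueGroup_zpow_injective ha0 hvp ?_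
      rw [← hk, zpow_mul, ← hj, zpow_natCast, ← pow_mul, mul_comm D, pow_mul,
        ← map_pow v (g : K) (k.natAbs + 1), ← Units.val_pow_eq_pow_val, hg]
    have hk0 : k = 0 := by
      have hdvd : ((k.natAbs + 1 : ℕ) : ℤ) ∣ k := ⟨j, by rw [mul_comm]; exact hkj⟩
      refine Int.eq_zero_of_dvd_of_natAbs_lt_natAbs hdvd ?_
      rw [Int.natAbs_natCast]
      exact Nat.lt_succ_self _
    rw [hk0, zpow_zero] at hk
    exact valueGroup_eq_one_of_pow_eq_one hD hk
  -- (2) it suffices that `f` be torsion: `μ(K)` is finite and roots of torsion are torsion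
  suffices hfin : IsOfFinOrder f by
    obtain ⟨g, hg⟩ := hf (Nat.card (CommGroup.torsion Kˣ)) Nat.card_pos
    have hgt : g ∈ CommGroup.torsion Kˣ := by
      obtain ⟨m, hm, hfm⟩ := isOfFinOrder_iff_pow_eq_one.mp hfin
      exact (CommGroup.mem_torsion _).mpr (isOfFinOrder_iff_pow_eq_one.mpr
        ⟨Nat.card (CommGroup.torsion Kˣ) * m, Nat.mul_pos Nat.card_pos hm,
          by rw [pow_mul, hg, hfm]⟩)
    have hgN : g ^ Nat.card (CommGroup.torsion Kˣ) = 1 := by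
      have := (pow_card_eq_one' : (⟨g, hgt⟩ : CommGroup.torsion Kˣ) ^ Nat.card _ = 1)
      exact congrArg Subtype.val this
    rw [← hg, hgN]
  -- (3) the residue class of `f` has finite order `m₀`
  have hvf : v (f : K) = 1 := hunit f hf
  obtain ⟨m₀, hm₀, hF⟩ := hres (f : K) hvf
  refine isOfFinOrder_iff_pow_eq_one.mpr ⟨m₀, hm₀, Units.ext ?_⟩
  rw [Units.val_pow_eq_pow_val, Units.val_one]
  -- (4) `F := f ^ m₀ ≡ 1` has `pⁿ`-th roots `≡ 1` for every `n`; contraction forces `F = 1`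
  have hroot : ∀ n : ℕ, ∃ G : K, G ^ p ^ n = (f : K) ^ m₀ ∧ v G = 1 := by
    intro n
    obtain ⟨g, hg⟩ := hf (p ^ n) (pow_pos hp.out.pos n)
    refine ⟨(g : K) ^ m₀, ?_, ?_⟩
    · rw [← pow_mul, mul_comm, pow_mul, ← Units.val_pow_eq_pow_val, hg]
    · have hvg : v (g : K) = 1 := by
        apply valueGroup_eq_one_of_pow_eq_one (pow_pos hp.out.pos n)
        rw [← map_pow, ← Units.val_pow_eq_pow_val, hg, hvf]
      rw [map_pow, hvg, one_pow]
  have hbound : ∀ n : ℕ, v ((f : K) ^ m₀ - 1) ^ D ≤ v (p : K) ^ n := by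
    intro n
    obtain ⟨G, hGF, hvG⟩ := hroot n
    have hG1 : v (G - 1) < 1 :=
      valuation_sub_one_lt_one_of_pow_prime_pow v hvp hvG.le n (by rw [hGF]; exact hF)
    calc v ((f : K) ^ m₀ - 1) ^ D = v (G ^ p ^ n - 1) ^ D := by rw [hGF]
      _ ≤ v (G - 1) ^ D * v (p : K) ^ n :=
          valuation_pow_pow_sub_one_pow_le v hvp hp0 hD hdisc hG1 n
      _ ≤ 1 * v (p : K) ^ n := mul_le_mul_left (valueGroup_pow_le_one hG1.le D) _
      _ = v (p : K) ^ n := one_mul _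
  have hF1 : (f : K) ^ m₀ - 1 = 0 :=
    eq_zero_of_forall_valuation_pow_le v ha0 hvp (hdisc _) hbound
  exact sub_eq_zero.mp hF1

end Literature.NumberTheory.GaloisRepresentations
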